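import Summits.NavierStokesRegularity.NavierStokesRegularity.Theorems.EulerZoomLiouvillePowerGaugeEulerLiouvilleWeakAxisymMember
import Summits.NavierStokesRegularity.NavierStokesRegularity.Theorems.EulerZoomLiouvillePowerGaugeEulerLiouvilleSelfSimilarSwirlRatchetAnyAxis
import HarnessLib

/-!
# Crux `EulerZoomLiouville.PowerGaugeEulerLiouville` (stmt-NavierStokesRegularity-19832), weak stratum, line `weak_axisym`:
# THE AXISYMMETRIC SWIRL-FREE WEAK MEMBER IS TRIVIAL ABOUT ANY AXIS (KEY W1-AX of the LEAD ns-typeII-p2 g16)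

Route №10 `EulerZoomLiouville` (NavierStokesRegularity), crux E = stmt-NavierStokesRegularity-19832; width seat ns-ezl-w1 g10 under the LEAD ns-typeII-p2.

`WeakAxisym.axisymNoSwirl_trivial` (ns-ezl-w1 g9, composition X0 ∘ X1a ∘ X1b ∘ X2 of the line `Cruxes/PowerGaugeEulerLiouville/Lines/weak_axisym.lean`,
ns-idea-11) kills the Ukhovskii–Yudovich axisymmetric swirl-free weak exactly self-similar stratum about the FIXED `x₃`-axis (`k × y = (−y₁, y₀, 0)`).
Seregin's class is `O(3)`-invariant and the self-similar ansatz commutes with linear isometries (`ClassIsometry.selfSimilar_ae_eq_zero_of_conj`,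
ns-ezl-w3 g3 over ns-ezl-w2 g3's `…ClassIsometry`), so the same stratum about ANY axis through the blow-up point is empty:

* `WeakAxisym.axisymNoSwirl_trivial_anyAxis` — `InClass ρ u p H c → IsExactlySelfSimilar ρ u p V P →` for some linear isometry `R` of `ℝ³` and some `G′`,
  the CONJUGATED profile `V′ := y ↦ R (V (R⁻¹ y))` satisfies `IsProfileGradient ρ V′ G′ → HasTransportDivergence ρ V′ → IsWeakAxisymNoSwirl V′ G′ → u = 0`
  a.e. on the past slab, every `ρ ∈ (0, ½]` (all line predicates unfolded, clause texts exactly as in `axisymNoSwirl_trivial` with `V′` in place of `V`).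

WHAT THIS IS NOT: not NS, not E, not the crux: a widening (fixed axis → any axis) of an already killed weak stratum; the weak stratum OFF the axisymmetric
swirl-free class (`stub_axisymFace`, X3) is untouched; 19832 is OPEN.
-/

noncomputable section

-- flat `Theorems/<Route><Decl>…` files of one crux share the namespace of the crux (tree convention)
set_option linter.dupNamespace false

open MeasureTheory Set Filter Topology Metric Function TopologicalSpace ContinuousLinearMap
open scoped ENNReal NNReal RealInnerProductSpace ContDiff

namespace Summit.NavierStokesRegularity.NavierStokesRegularity.Theorems.PowerGaugeEulerLiouville.WeakAxisym

open Literature.Analysis Literature.Analysis.FunctionSpaces Literature.Analysis.FluidPDE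
open Summit.NavierStokesRegularity.NavierStokesRegularity.Theorems.PowerGaugeEulerLiouville

/-- **The axisymmetric swirl-free weak exactly self-similar member is trivial ABOUT ANY AXIS** (every `ρ ∈ (0, ½]`): for a member of the class
(`InClass`, unfolded) that is exactly self-similar with profile `(V, P)` (`IsExactlySelfSimilar`), if for some linear isometry `R` of `ℝ³` the conjugated
profile `V′ = y ↦ R (V (R⁻¹ y))` carries DiPerna–Lions data `(V′, G′)` (`IsProfileGradient`), `div W′ = 3γ` (`HasTransportDivergence`) and lies on the
Ukhovskii–Yudovich axisymmetric swirl-free stratum about the `x₃`-axis (`IsWeakAxisymNoSwirl V′ G′`: `G′(k×y) = k×V′` a.e., `⟪V′, k×y⟫ = 0` a.e.,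
`V′_ϱ/ϱ ∈ L²_loc`, `η′ = ⟪curl, k×y⟫/ϱ² ∈ L²_loc` of growth `m < 1`) — i.e. `V` itself is UY-axisymmetric swirl-free about the axis `R⁻¹(ℝ e₃)` — then
`u = 0` a.e. on the past slab.  Proof: `ClassIsometry.selfSimilar_ae_eq_zero_of_conj` transports the class binders and the ansatz to the conjugated member,
which `axisymNoSwirl_trivial` kills. -/
theorem axisymNoSwirl_trivial_anyAxis {ρ : ℝ} (hρ : 0 < ρ) (hρh : ρ ≤ 1 / 2)
    {u : ℝ → EuclideanSpace ℝ (Fin 3) → EuclideanSpace ℝ (Fin 3)} {p : ℝ → EuclideanSpace ℝ (Fin 3) → ℝ}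
    {H : ℝ → EuclideanSpace ℝ (Fin 3) → EuclideanSpace ℝ (Fin 3) →L[ℝ] EuclideanSpace ℝ (Fin 3)} {c : ℝ≥0}
    {V : EuclideanSpace ℝ (Fin 3) → EuclideanSpace ℝ (Fin 3)} {P : EuclideanSpace ℝ (Fin 3) → ℝ}
    (hcls : IsSuitableWeakSolutionOn (slab (EuclideanSpace ℝ (Fin 3)) (Set.Iio 0) isOpen_Iio) 0 0 u p ∧
      HasWeakSpatialGradientOn (slab (EuclideanSpace ℝ (Fin 3)) (Set.Iio 0) isOpen_Iio) u H ∧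
      (∀ a : ℝ, 0 < a →
        ENNReal.ofReal (a ^ (2 * ρ)) * cknA a (0 : ℝ × EuclideanSpace ℝ (Fin 3)) u +
            ENNReal.ofReal (a ^ ρ) * cknE a (0 : ℝ × EuclideanSpace ℝ (Fin 3)) H +
          ENNReal.ofReal (a ^ (2 * ρ)) * cknD a (0 : ℝ × EuclideanSpace ℝ (Fin 3)) p ≤ (c : ℝ≥0∞)))
    (hss : (∀ τ : ℝ, τ < 0 → u τ = selfSimilarCollapse (1 / (2 + ρ)) 0 V τ) ∧
      (∀ τ : ℝ, τ < 0 → p τ = selfSimilarCollapsePressure (1 / (2 + ρ)) 0 P τ))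
    (R : EuclideanSpace ℝ (Fin 3) ≃ₗᵢ[ℝ] EuclideanSpace ℝ (Fin 3))
    {G' : EuclideanSpace ℝ (Fin 3) → EuclideanSpace ℝ (Fin 3) →L[ℝ] EuclideanSpace ℝ (Fin 3)}
    (hPG' : HasWeakFDerivOn (⊤ : Opens (EuclideanSpace ℝ (Fin 3))) volume (fun y => R (V (R.symm y))) G' ∧
      (∀ r : ℝ, MemLp G' 2 (volume.restrict (ball (0 : EuclideanSpace ℝ (Fin 3)) r))) ∧
      (∀ r : ℝ, MemLp (fun y => R (V (R.symm y))) 6 (volume.restrict (ball (0 : EuclideanSpace ℝ (Fin 3)) r))) ∧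
      HasWeakFDerivOn (⊤ : Opens (EuclideanSpace ℝ (Fin 3))) volume (selfSimilarTransport (1 / (2 + ρ)) 0 (fun y => R (V (R.symm y))))
        (fun x => (1 / (2 + ρ)) • ContinuousLinearMap.id ℝ (EuclideanSpace ℝ (Fin 3)) + G' x))
    (hdiv' : ∀ φ : EuclideanSpace ℝ (Fin 3) → ℝ, IsTestFunctionOn (⊤ : Opens (EuclideanSpace ℝ (Fin 3))) φ →
      ∫ y, ⟪selfSimilarTransport (1 / (2 + ρ)) 0 (fun y => R (V (R.symm y))) y, gradient φ y⟫ = -(3 * (1 / (2 + ρ))) * ∫ y, φ y)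
    (hax' : (∀ᵐ y ∂(volume : Measure (EuclideanSpace ℝ (Fin 3))),
        G' y (WithLp.toLp 2 ![-(y 1), y 0, 0]) = WithLp.toLp 2 ![-((fun y => R (V (R.symm y))) y 1), (fun y => R (V (R.symm y))) y 0, 0]) ∧
      (∀ᵐ y ∂(volume : Measure (EuclideanSpace ℝ (Fin 3))), ⟪(fun y => R (V (R.symm y))) y, WithLp.toLp 2 ![-(y 1), y 0, 0]⟫ = 0) ∧
      (∀ r : ℝ, MemLp (fun y => ⟪(fun y => R (V (R.symm y))) y, WithLp.toLp 2 ![y 0, y 1, 0]⟫ / (y 0 ^ 2 + y 1 ^ 2)) 2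
        (volume.restrict (ball (0 : EuclideanSpace ℝ (Fin 3)) r))) ∧
      (∀ r : ℝ, MemLp (fun y => ⟪curlCLM (G' y), WithLp.toLp 2 ![-(y 1), y 0, 0]⟫ / (y 0 ^ 2 + y 1 ^ 2)) 2
        (volume.restrict (ball (0 : EuclideanSpace ℝ (Fin 3)) r))) ∧
      (∃ C m : ℝ, m < 1 ∧ ∀ R : ℝ, 1 ≤ R →
        ∫ y in ball (0 : EuclideanSpace ℝ (Fin 3)) R,
          (⟪curlCLM (G' y), WithLp.toLp 2 ![-(y 1), y 0, 0]⟫ / (y 0 ^ 2 + y 1 ^ 2)) ^ 2 ≤ C * R ^ m)) :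
    Function.uncurry u =ᵐ[volume.restrict (Set.Iio (0 : ℝ) ×ˢ (Set.univ : Set (EuclideanSpace ℝ (Fin 3))))] 0 := by
  -- transport the class binders and the ansatz to the conjugated member (ns-ezl-w3 g3 / ns-ezl-w2 g3), then kill it by the fixed-axis member (ns-ezl-w1 g9)
  refine ClassIsometry.selfSimilar_ae_eq_zero_of_conj hcls.1 hcls.2.1 hcls.2.2 hss.1 hss.2 R ?_
  intro u' p' H' hsw' hH' hg' hu' hp'
  exact axisymNoSwirl_trivial hρ hρh ⟨hsw', hH', hg'⟩ ⟨hu', hp'⟩ hPG' hdiv' hax'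

end Summit.NavierStokesRegularity.NavierStokesRegularity.Theorems.PowerGaugeEulerLiouville.WeakAxisym

end
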